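import Summits.Parity.GeneralizedHardyLittlewood.Theorems.PrimeLevelFamEdgeMomentsBeyondDiagonalLayersRegroup
import Summits.Parity.GeneralizedHardyLittlewood.Theorems.PrimeLevelFamEdgeMomentsBeyondDiagonalLayersFourierBound
import HarnessLib

/-!
# Route `PrimeLevelFamEdge`, crux K_A `MomentsBeyondDiagonal` (stmt-Parity-20007), line «petersson_layers» v4:
# the PARSEVAL FLOOR for a regrouped four-variable layer form — `‖Σ A·B·κ‖ ≤ c·√(D₁D₂)·‖A‖₂‖B‖₂`

Composition of the line's bricks at the level of one separated form of a Petersson layer block (modulus `c`):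
regrouping in `(u, v) = (m₁m₂, n₁n₂)` (`…LayersRegroup`), the completion bound `‖Σ α_u β_v S(u,v;c)‖ ≤ c‖α‖₂‖β‖₂`
(`…LayersFourierBound`) and the convolution `ℓ²` bounds `‖α‖₂² ≤ D₁ Σ|A|²`, `‖β‖₂² ≤ D₂ Σ|B|²` (`…LayersConvolutionL2`):
for `X₁X₂ ≤ c`, `Y₁Y₂ ≤ c`, divisor bounds `τ ≤ D₁` on `[1, X₁X₂]`, `τ ≤ D₂` on `[1, Y₁Y₂]`, and a kernel equal to `S(m₁m₂, n₁n₂; c)`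
on the support,

  `‖Σ_{m₁,n₁,m₂,n₂} A(m₁,m₂) B(n₁,n₂) κ(m₁,n₁,m₂,n₂)‖ ≤ c · √D₁ · √D₂ · (Σ|A|²)^{1/2} (Σ|B|²)^{1/2}`   (`norm_sum_four_le_fourier`).

This is deck 21c's «(T1′) Parseval floor» for ONE Petersson modulus, now a theorem about the actual regrouped forms; with the
Pascadi bridge (`…LayersPascadiBridge`) in place of `…LayersFourierBound` the same composition gives the print-band saving.
Proof only (def-free helper); no layer is bounded here; K_A NOT proved; nothing about Landau–Siegel zeros.
-/

noncomputable section

open Finset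
open Literature.NumberTheory.LFunctions

namespace Summit.Parity.GeneralizedHardyLittlewood.Theorems.MomentsBeyondDiagonal.Layers

/-- **The Parseval floor for a regrouped separated form** (any modulus `c ≥ 1`; `X₁X₂, Y₁Y₂ ≤ c`; `τ ≤ D₁`, `τ ≤ D₂` on the
product ranges, `D₁, D₂ ≥ 0`; kernel `= S(m₁m₂, n₁n₂; c)` on the support of `A·B`).
[cite: KerrShparlinskiWuXi2023, §1.1 (the trivial Fourier bound)] -/
theorem norm_sum_four_le_fourier {c : ℕ} [NeZero c] (X₁ X₂ Y₁ Y₂ : ℕ) (hX : X₁ * X₂ ≤ c) (hY : Y₁ * Y₂ ≤ c)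
    (A B : ℕ → ℕ → ℂ) (κ : ℕ → ℕ → ℕ → ℕ → ℂ)
    (hgood : ∀ m₁ ∈ Icc 1 X₁, ∀ m₂ ∈ Icc 1 X₂, ∀ n₁ ∈ Icc 1 Y₁, ∀ n₂ ∈ Icc 1 Y₂, A m₁ m₂ * B n₁ n₂ ≠ 0 →
      κ m₁ n₁ m₂ n₂ = kloostermanSum c ((m₁ * m₂ : ℕ) : ZMod c) ((n₁ * n₂ : ℕ) : ZMod c))
    {D₁ D₂ : ℝ} (hD₁0 : 0 ≤ D₁) (hD₂0 : 0 ≤ D₂)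
    (hD₁ : ∀ u ∈ Icc 1 (X₁ * X₂), (#u.divisors : ℝ) ≤ D₁) (hD₂ : ∀ v ∈ Icc 1 (Y₁ * Y₂), (#v.divisors : ℝ) ≤ D₂) :
    ‖∑ m₁ ∈ Icc 1 X₁, ∑ n₁ ∈ Icc 1 Y₁, ∑ m₂ ∈ Icc 1 X₂, ∑ n₂ ∈ Icc 1 Y₂, A m₁ m₂ * B n₁ n₂ * κ m₁ n₁ m₂ n₂‖ ≤
      (c : ℝ) * Real.sqrt D₁ * Real.sqrt D₂ *
        Real.sqrt (∑ p ∈ Icc 1 X₁ ×ˢ Icc 1 X₂, ‖A p.1 p.2‖ ^ 2) *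
        Real.sqrt (∑ p ∈ Icc 1 Y₁ ×ˢ Icc 1 Y₂, ‖B p.1 p.2‖ ^ 2) := by
  -- regroup in `(u, v)`
  rw [sum_four_eq_bilinear_fiber_of_support X₁ X₂ Y₁ Y₂ A B κ
    (fun u v ↦ kloostermanSum c ((u : ℕ) : ZMod c) ((v : ℕ) : ZMod c)) hgood]
  -- the completion bound, then the convolution ℓ² bounds
  refine (norm_bilinear_kloostermanSum_Icc_le (c := c) hX hY _ _).trans ?_
  have hA := norm_sq_fiber_sum_sum_le X₁ X₂ (fun p : ℕ × ℕ ↦ A p.1 p.2) hD₁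
  have hB := norm_sq_fiber_sum_sum_le Y₁ Y₂ (fun p : ℕ × ℕ ↦ B p.1 p.2) hD₂
  have h1 : Real.sqrt (∑ u ∈ Icc 1 (X₁ * X₂),
      ‖∑ p ∈ (Icc 1 X₁ ×ˢ Icc 1 X₂).filter (fun p : ℕ × ℕ ↦ p.1 * p.2 = u), A p.1 p.2‖ ^ 2) ≤
      Real.sqrt D₁ * Real.sqrt (∑ p ∈ Icc 1 X₁ ×ˢ Icc 1 X₂, ‖A p.1 p.2‖ ^ 2) := by
    rw [← Real.sqrt_mul hD₁0]
    exact Real.sqrt_le_sqrt hA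
  have h2 : Real.sqrt (∑ v ∈ Icc 1 (Y₁ * Y₂),
      ‖∑ p ∈ (Icc 1 Y₁ ×ˢ Icc 1 Y₂).filter (fun p : ℕ × ℕ ↦ p.1 * p.2 = v), B p.1 p.2‖ ^ 2) ≤
      Real.sqrt D₂ * Real.sqrt (∑ p ∈ Icc 1 Y₁ ×ˢ Icc 1 Y₂, ‖B p.1 p.2‖ ^ 2) := by
    rw [← Real.sqrt_mul hD₂0]
    exact Real.sqrt_le_sqrt hB
  have hc : (0 : ℝ) ≤ c := Nat.cast_nonneg c
  calc (c : ℝ) * Real.sqrt (∑ u ∈ Icc 1 (X₁ * X₂),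
          ‖∑ p ∈ (Icc 1 X₁ ×ˢ Icc 1 X₂).filter (fun p : ℕ × ℕ ↦ p.1 * p.2 = u), A p.1 p.2‖ ^ 2) *
        Real.sqrt (∑ v ∈ Icc 1 (Y₁ * Y₂),
          ‖∑ p ∈ (Icc 1 Y₁ ×ˢ Icc 1 Y₂).filter (fun p : ℕ × ℕ ↦ p.1 * p.2 = v), B p.1 p.2‖ ^ 2)
      ≤ (c : ℝ) * (Real.sqrt D₁ * Real.sqrt (∑ p ∈ Icc 1 X₁ ×ˢ Icc 1 X₂, ‖A p.1 p.2‖ ^ 2)) *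
          (Real.sqrt D₂ * Real.sqrt (∑ p ∈ Icc 1 Y₁ ×ˢ Icc 1 Y₂, ‖B p.1 p.2‖ ^ 2)) :=
        mul_le_mul (mul_le_mul_of_nonneg_left h1 hc) h2 (Real.sqrt_nonneg _) (by positivity)
    _ = _ := by ring

end Summit.Parity.GeneralizedHardyLittlewood.Theorems.MomentsBeyondDiagonal.Layers

end
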